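import Summits.Ventures.Crystal3D.Kissing125.GSearchSearch1
import HarnessLib

/-!
# Soundness of bisection and of the search, κ-generic — part 2/3

HONEST FRAMING (cell pub-crystal3d, K-path at `h = 5/4`, V4 = κ as an explicit parameter): this is NOT a result printed
by Hales; it is his METHOD (arXiv:1209.6043, Theorem 3 + Lemmas 7–10, in the tree's form of a verified interval-arithmetic
growth search, `Literature/…/KissingSearch*.lean`) with the largest long-side cosine `κ` made an EXPLICIT PARAMETER
(`κ : Kappa`, carrying the two numeric facts the soundness proof uses: `-1/2 ≤ κ`, `κ < 1/4`).  Only the declarations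
whose statement depends on `κ` are declared here (namespace `…Kissing125.GSearch`, the tree's short names, no renames);
every κ-free helper is the landed K25 copy (`…Kissing125.KissingSearch.*`) and every κ-free lemma is cited from the tree
(PRIVATE per-file citation aliases; `GSearchTransport.lean` holds `toT : St → tree St` and the transport equalities).  The K25
instance is `κ25 = ⟨7/32, …⟩`; `GSearchBridge.lean` identifies the generic checker at
`κ25` with the landed `Kissing125.KissingSearch.checkPart`, so the landed run files are consumed unchanged.  Generated by
`HOME/lean/kissing125/v4-prep/gen/mkgen.py`; nothing here is asserted about GAP(1.26) or any census.

THIS FILE: the κ-tainted declarations of `Literature/Geometry/DiscreteGeometry/KissingSearchSearch.lean` (part 2 of 3), with `κ : Kappa` threaded; κ-free declarations of that file are NOT re-declared publicly (the κ-free helpers are the landed K25 copies; the κ-free tree lemmas used by the proofs are cited through PRIVATE aliases at the top of the file).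

## References
* T. C. Hales, *A proof of Fejes Tóth's conjecture on sphere packings with kissing number twelve*,
  arXiv:1209.6043 (2012): Definition 1, Theorem 2, Theorem 3, Lemmas 7–10. [`Hales2012`]
* R. E. Moore, *Interval Analysis* (1966), Theorem 3.1, §4.4. [`Moore1966`]
-/

namespace Summit.Ventures.Crystal3D.Kissing125

open Literature.Geometry.DiscreteGeometry
open Summit.Ventures.Crystal3D.Kissing125.KissingSearch

namespace GSearch

open Real Literature.Analysis.ValidatedNumerics KissingLP NonemptyInterval Finset

variable {κ : Kappa}

/-! ### κ-free tree lemmas used below, read over the K25 copies (PRIVATE citation aliases; the public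
surface of this file is κ-generic only) -/

/-- K25 reading of the tree lemma `rHi_mkR` (κ-free; proof = citation of the tree lemma). [folklore] -/
private theorem rHi_mkR {lo hi : ℕ} (h : hi < 16) : rHi (mkR lo hi) = hi :=
  Literature.Geometry.DiscreteGeometry.KissingSearch.rHi_mkR h

/-- K25 reading of the tree lemma `rLo_mkR` (κ-free; proof = citation of the tree lemma). [folklore] -/
private theorem rLo_mkR {lo hi : ℕ} (h : hi < 16) : rLo (mkR lo hi) = lo :=
  Literature.Geometry.DiscreteGeometry.KissingSearch.rLo_mkR h

/-- K25 reading of the tree lemma `validDom_mkR` (κ-free; proof = citation of the tree lemma). [folklore] -/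
private theorem validDom_mkR {lo hi : ℕ} (h1 : 1 ≤ lo) (h2 : lo ≤ hi) (h3 : hi ≤ K) :
  ValidDom (mkR lo hi) :=
  Literature.Geometry.DiscreteGeometry.KissingSearch.validDom_mkR h1 h2 h3

/-- K25 reading of the tree lemma `widest_some` (κ-free; proof = citation of the tree lemma). [folklore] -/
private theorem widest_some {s : St} {a b : ℕ} (h : s.widest = some (a, b)) :
  a < b ∧ b < 12 ∧ s.gdom a b ≠ 0 ∧ s.gdom a b ≠ UNL ∧ s.gsc a b ≠ 0 ∧ rLo (s.gdom a b) < rHi (s.gdom a b) :=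
  Literature.Geometry.DiscreteGeometry.KissingSearch.widest_some (s := toT s) (by rw [← widest_tr]; exact h)

/-- K25 reading of the tree lemma `tris_sdom` (κ-free; proof = citation of the tree lemma). [folklore] -/
@[simp] private theorem tris_sdom {s : St} (a b r : ℕ) : (s.sdom a b r).tris = s.tris :=
  Literature.Geometry.DiscreteGeometry.KissingSearch.tris_sdom (s := toT s) a b r

/-- K25 reading of the tree lemma `sc_sdom` (κ-free; proof = citation of the tree lemma). [folklore] -/
@[simp] private theorem sc_sdom {s : St} (a b r : ℕ) : (s.sdom a b r).sc = s.sc :=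
  Literature.Geometry.DiscreteGeometry.KissingSearch.sc_sdom (s := toT s) a b r

/-- K25 reading of the tree lemma `size_dom_sdom` (κ-free; proof = citation of the tree lemma). [folklore] -/
@[simp] private theorem size_dom_sdom {s : St} (a b r : ℕ) :
  (s.sdom a b r).dom.size = s.dom.size :=
  Literature.Geometry.DiscreteGeometry.KissingSearch.size_dom_sdom (s := toT s) a b r

/-- K25 reading of the tree lemma `gsc_sdom` (κ-free; proof = citation of the tree lemma). [folklore] -/
@[simp] private theorem gsc_sdom {s : St} (a b r p q : ℕ) :
  (s.sdom a b r).gsc p q = s.gsc p q :=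
  Literature.Geometry.DiscreteGeometry.KissingSearch.gsc_sdom (s := toT s) a b r p q


section Complete
variable {M : KConf κ} {s : St}
/-- **Soundness of `isoTo`.** [cite: Hales2012, Lemma 9] -/
theorem concl_of_isoTo {M : KConf κ} {s : St} (hR : Realizes M s) (hall : ∀ t'' ∈ M.T, ∃ t ∈ s.tris.toList, tset t = t'')
    {i : Fin 8} (hi : i = 0 ∨ i = 1) {perm : List ℕ} (h : s.isoTo i perm = true) : M.Concl := by
  unfold St.isoTo at h
  simp only [Bool.and_eq_true, beq_iff_eq, List.all_eq_true, List.mem_range, Bool.or_eq_true, bne_iff_ne,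
    ne_eq] at h
  obtain ⟨⟨-, hinj⟩, hadj⟩ := h
  -- every image is `< 12`
  have hlt : ∀ a, a < 12 → perm.getD a 12 < 12 := by
    intro a ha
    have := hadj a ha a ha
    split_ifs at this with hh
    exact hh.1
  let f : Fin 12 → Fin 12 := fun a => ⟨perm.getD a 12, hlt a a.2⟩
  have hf : Function.Injective f := by
    intro a b e
    have e' : perm.getD a 12 = perm.getD b 12 := by simpa [f] using congrArg Fin.val e
    by_contra hab
    have := hinj a a.2 b b.2
    rcases this with h | h
    · exact hab (Fin.ext h)
    · exact h e'
  have hfb : Function.Bijective f := (Finite.injective_iff_bijective).1 hf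
  refine ⟨i, hi, Equiv.ofBijective f hfb, fun a b => ?_⟩
  have h := hadj a a.2 b b.2
  rw [dif_pos ⟨hlt a a.2, hlt b b.2⟩] at h
  rw [← adjB_iff hR hall a.2 b.2]
  have h' := beq_iff_eq.1 h
  show s.adjB a b = true ↔ tameAdjM i (f a) (f b) = true
  rw [h']

/-- **Soundness of `accept`.** [cite: Hales2012, Lemma 9] -/
theorem accept_sound {M : KConf κ} {s : St} (hR : Realizes M s) (hall : ∀ t'' ∈ M.T, ∃ t ∈ s.tris.toList, tset t = t'')
    (h : s.accept = true) : M.Concl := by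
  unfold St.accept at h
  revert h
  cases s.findIso 1 20 [] with
  | some p => intro h; exact concl_of_isoTo hR hall (Or.inr rfl) h
  | none =>
    simp only
    cases s.findIso 0 20 [] with
    | some p => intro h; exact concl_of_isoTo hR hall (Or.inl rfl) h
    | none => intro h; cases h

/-- **Soundness of `refute`**: a realized state is never refuted. [cite: Moore1966, §4.4] -/
theorem refute_sound (fuel : ℕ) : ∀ (s : St), Realizes M s → St.refute κ s fuel = true → False := by
  induction fuel with
  | zero => intro s _ h; simp [St.refute] at h
  | succ fuel ih =>
    intro s hR h
    rw [St.refute] at h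
    obtain ⟨n1, k1⟩ := propagate_sound hR 300
    revert h
    cases hp : St.propagate κ s 300 with
    | none => exact absurd hp n1
    | some s₁ =>
      obtain ⟨hR1, -⟩ := k1 s₁ hp
      simp only
      cases hw : s₁.widest with
      | none => intro h; cases h
      | some p =>
        obtain ⟨a, b⟩ := p
        simp only [Bool.and_eq_true]
        rintro ⟨h1, h2⟩
        obtain ⟨hab, hb, hr0, hrU, -, hw'⟩ := widest_some hw
        have ha : a < 12 := by omega
        rcases hR1.dom a b ha hb (ne_of_lt hab) with h | ⟨h, -⟩ | ⟨vd, -, hxne, hxlo, hxhi⟩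
        · exact hrU h
        · exact hr0 h
        rcases vd with h | ⟨hl1, hl2, hl3, -⟩
        · exact hr0 h
        have hm1 : rLo (s₁.gdom a b) ≤ (rLo (s₁.gdom a b) + rHi (s₁.gdom a b)) / 2 := by omega
        have hm2 : (rLo (s₁.gdom a b) + rHi (s₁.gdom a b)) / 2 < rHi (s₁.gdom a b) := by omega
        have hK : K = 15 := rfl
        by_cases hx : M.g a b ≤ ((gridPt κ ((rLo (s₁.gdom a b) + rHi (s₁.gdom a b)) / 2) : ℚ) : ℝ)
        · refine ih _ (hR1.sdom ha hb (ne_of_lt hab) hrU ?_ ?_) h1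
          · unfold mkR UNL; omega
          · have v1 : ValidDom (mkR (rLo (s₁.gdom a b)) ((rLo (s₁.gdom a b) + rHi (s₁.gdom a b)) / 2)) :=
              validDom_mkR hl1 hm1 (by omega)
            have elo : rLo (mkR (rLo (s₁.gdom a b)) ((rLo (s₁.gdom a b) + rHi (s₁.gdom a b)) / 2)) = rLo (s₁.gdom a b) :=
              rLo_mkR (by omega)
            have ehi : rHi (mkR (rLo (s₁.gdom a b)) ((rLo (s₁.gdom a b) + rHi (s₁.gdom a b)) / 2)) =
                (rLo (s₁.gdom a b) + rHi (s₁.gdom a b)) / 2 := rHi_mkR (by omega)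
            exact Or.inr (Or.inr ⟨v1, by unfold mkR; omega, hxne, by rw [elo]; exact hxlo, by rw [ehi]; exact hx⟩)
        · refine ih _ (hR1.sdom ha hb (ne_of_lt hab) hrU ?_ ?_) h2
          · unfold mkR UNL; omega
          · have v1 : ValidDom (mkR ((rLo (s₁.gdom a b) + rHi (s₁.gdom a b)) / 2 + 1) (rHi (s₁.gdom a b))) :=
              validDom_mkR (by omega) (by omega) hl3
            have elo : rLo (mkR ((rLo (s₁.gdom a b) + rHi (s₁.gdom a b)) / 2 + 1) (rHi (s₁.gdom a b))) =
                (rLo (s₁.gdom a b) + rHi (s₁.gdom a b)) / 2 + 1 := rLo_mkR (by omega)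
            have ehi : rHi (mkR ((rLo (s₁.gdom a b) + rHi (s₁.gdom a b)) / 2 + 1) (rHi (s₁.gdom a b))) = rHi (s₁.gdom a b) :=
              rHi_mkR (by omega)
            refine Or.inr (Or.inr ⟨v1, by unfold mkR; omega, hxne, ?_, by rw [ehi]; exact hxhi⟩)
            rw [elo, Nat.add_sub_cancel]
            exact (not_le.1 hx).le

end Complete

/-! ### Part C. The search -/

section Search

/-- The third vertex of the missing triangle on an open side. [folklore] -/
theorem exists_third {M : KConf κ} {s : St} (hR : Realizes M s) {v a b : ℕ} (hv : v < 12) (ha : a < 12)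
    (hav : a ≠ v) (h1 : s.gsc v a = 1) {t₀ : ℕ} (ht₀ : t₀ ∈ s.tris.toList) (hset₀ : tset t₀ = {v, a, b}) :
    ∃ c, c < 12 ∧ c ≠ v ∧ c ≠ a ∧ c ≠ b ∧ ({v, a, c} : Finset ℕ) ∈ M.T ∧
      ∀ t ∈ s.tris.toList, tset t ≠ {v, a, c} := by
  classical
  obtain ⟨t'', hT, hv'', ha'', hun⟩ := exists_unplaced_of_gsc_one hR hv ha (Ne.symm hav) h1
  obtain ⟨hc3, hlt⟩ := M.mem_T t'' hT
  have hva : ({v, a} : Finset ℕ) ⊆ t'' := by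
    intro x hx; simp only [Finset.mem_insert, Finset.mem_singleton] at hx
    rcases hx with rfl | rfl
    · exact hv''
    · exact ha''
  have hcard : (t'' \ {v, a}).card = 1 := by
    rw [Finset.card_sdiff_of_subset hva, hc3, Finset.card_pair (Ne.symm hav)]
  obtain ⟨c, hc⟩ := Finset.card_eq_one.1 hcard
  have hcm : c ∈ t'' \ {v, a} := by rw [hc]; simp
  rw [Finset.mem_sdiff] at hcm
  obtain ⟨hct, hcva⟩ := hcm
  simp only [Finset.mem_insert, Finset.mem_singleton, not_or] at hcva
  have heq : t'' = {v, a, c} := by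
    have : t'' = {v, a} ∪ (t'' \ {v, a}) := (Finset.union_sdiff_of_subset hva).symm
    rw [this, hc]
    ext x; simp only [Finset.mem_union, Finset.mem_insert, Finset.mem_singleton]; tauto
  refine ⟨c, hlt c hct, hcva.1, hcva.2, ?_, heq ▸ hT, fun t ht e => hun t ht (by rw [e, heq])⟩
  rintro rfl
  exact hun t₀ ht₀ (by rw [hset₀, heq])

/-- **The root normalisation is invariant under a swap fixing `0, …, 4`.** [folklore] -/
theorem rootInv_relabel_swap (M : KConf κ) {c n : ℕ} (hc5 : 5 ≤ c) (hn5 : 5 ≤ n)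
    (hσ : ∀ a, (Equiv.swap c n) a < 12 ↔ a < 12) (hI : M.RootInv) : (M.relabel (Equiv.swap c n) hσ).RootInv := by
  classical
  have fix : ∀ x, x < 5 → (Equiv.swap c n) x = x := fun x hx =>
    Equiv.swap_apply_of_ne_of_ne (by omega) (by omega)
  have hg : ∀ p q, p < 5 → q < 5 → (M.relabel (Equiv.swap c n) hσ).g p q = M.g p q := by
    intro p q hp hq
    show M.g ((Equiv.swap c n).symm p) ((Equiv.swap c n).symm q) = M.g p q
    rw [Equiv.symm_swap, fix p hp, fix q hq]
  have hty : ∀ p q, p < 5 → q < 5 → (M.relabel (Equiv.swap c n) hσ).ty p q = M.ty p q := by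
    intro p q hp hq; unfold KConf.ty; rw [hg p q hp hq]
  obtain ⟨h1, h2, h3⟩ := hI
  refine ⟨?_, ?_, ?_⟩
  · rw [← h1]
    refine Finset.card_bij (fun u _ => (Equiv.swap c n) u) ?_ ?_ ?_
    · intro u hu
      simp only [Finset.mem_filter, Finset.mem_range] at hu ⊢
      obtain ⟨hu12, hu0, hgu⟩ := hu
      refine ⟨(hσ u).2 hu12, fun e => hu0 ?_, ?_⟩
      · have := congrArg (Equiv.swap c n) e
        rw [Equiv.swap_apply_self, fix 0 (by norm_num)] at this; exact this
      · change M.g ((Equiv.swap c n).symm 0) ((Equiv.swap c n).symm u) = 1 / 2 at hgu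
        rw [Equiv.symm_swap, fix 0 (by norm_num)] at hgu
        exact hgu
    · intro u _ u' _ e; exact (Equiv.swap c n).injective e
    · intro w hw
      simp only [Finset.mem_filter, Finset.mem_range] at hw
      refine ⟨(Equiv.swap c n) w, ?_, by rw [Equiv.swap_apply_self]⟩
      simp only [Finset.mem_filter, Finset.mem_range]
      refine ⟨(hσ w).2 hw.1, fun e => hw.2.1 ?_, ?_⟩
      · have := congrArg (Equiv.swap c n) e
        rw [Equiv.swap_apply_self, fix 0 (by norm_num)] at this; exact this
      · show M.g ((Equiv.swap c n).symm 0) ((Equiv.swap c n).symm ((Equiv.swap c n) w)) = 1 / 2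
        rw [Equiv.symm_swap, fix 0 (by norm_num), Equiv.swap_apply_self]; exact hw.2.2
  · intro u w hu hw
    -- long sides of the relabelled structure through `0` are images of long sides through `0`
    have back : ∀ {x : ℕ}, ({0, x} : Finset ℕ) ∈ (M.relabel (Equiv.swap c n) hσ).longSides →
        ({0, (Equiv.swap c n) x} : Finset ℕ) ∈ M.longSides := by
      intro x hx
      unfold KConf.longSides at hx ⊢
      rw [Finset.mem_filter, KConf.mem_sides] at hx ⊢
      obtain ⟨⟨hc2, t, ht, hsub⟩, p, hp, q, hq, hpq, hgpq⟩ := hx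
      change t ∈ M.T.image (relab (Equiv.swap c n)) at ht
      rw [Finset.mem_image] at ht
      obtain ⟨t₀, ht₀, rfl⟩ := ht
      have h0x : (0 : ℕ) ≠ x := by
        intro e; rw [← e] at hc2; simp at hc2
      have hx0 : (Equiv.swap c n) x ≠ 0 := by
        intro e; apply h0x
        have := congrArg (Equiv.swap c n) e
        rw [Equiv.swap_apply_self, fix 0 (by norm_num)] at this; exact this.symm
      refine ⟨⟨by rw [Finset.card_pair (Ne.symm hx0)], t₀, ht₀, ?_⟩, 0, by simp, (Equiv.swap c n) x, by simp, Ne.symm hx0, ?_⟩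
      · intro y hy
        simp only [Finset.mem_insert, Finset.mem_singleton] at hy
        rcases hy with rfl | rfl
        · have := hsub (show (0 : ℕ) ∈ ({0, x} : Finset ℕ) by simp)
          rw [mem_relab_iff, Equiv.symm_swap, fix 0 (by norm_num)] at this; exact this
        · have := hsub (show x ∈ ({0, x} : Finset ℕ) by simp)
          rw [mem_relab_iff, Equiv.symm_swap] at this; exact this
      · -- the long pair is `{0, x}` in some order
        simp only [Finset.mem_insert, Finset.mem_singleton] at hp hq
        change M.g ((Equiv.swap c n).symm p) ((Equiv.swap c n).symm q) ≠ 1 / 2 at hgpq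
        rw [Equiv.symm_swap] at hgpq
        rcases hp with rfl | rfl <;> rcases hq with rfl | rfl
        · exact absurd rfl hpq
        · rw [fix 0 (by norm_num)] at hgpq; exact hgpq
        · rw [fix 0 (by norm_num), M.g_symm] at hgpq; exact hgpq
        · exact absurd rfl hpq
    have := h2 _ _ (back hu) (back hw)
    exact (Equiv.swap c n).injective this
  · rw [hty 0 4 (by norm_num) (by norm_num), hty 0 3 (by norm_num) (by norm_num), hty 2 4 (by norm_num) (by norm_num),
      hty 1 3 (by norm_num) (by norm_num)]
    exact h3

end Search

end GSearch

end Summit.Ventures.Crystal3D.Kissing125
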